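import Summits.NavierStokesRegularity.NavierStokesRegularity.Theorems.PoloidalWindowDoorPoloidalWindowRigidityZShockRiccatiTwoSided
import HarnessLib

/-!
# Crux K2 `PoloidalWindowRigidity` (stmt-NavierStokesRegularity-19708), line `z_shock` — the two-sided Riccati lemma
# under NON-UNIFORM genuine nonlinearity: divergence of `∫ b` is the exact condition, and strict positivity of `b` is not

`--supports stmt-NavierStokesRegularity-19708 --as helper` (leafhand-ns-poloidalwindowdoor-3 g2, cell decomp-ns, 2026-08-31).
Class-free real analysis, Mathlib + the tree file `…ZShockRiccatiTwoSided` only.  **No stub and no summit is closed by this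
file; Navier–Stokes regularity is NOT proved here (rung 0).**

WHY THIS FILE.  Rung R2 of `Cruxes/PoloidalWindowRigidity/Lines/z_shock.md` (the 1-D shadow of the deciding stub
`stub_zShockThickAut`) is a tree theorem under UNIFORM genuine nonlinearity `κ'(w) ≥ k₀ > 0` along the solution
(`…ZShockPSystemLiouvilleAlong.pSystem_const_along`, `…ZShockRiemannInvariantLiouville.riemannInvariant_const`), through the
ODE kernel `…ZShockRiccatiTwoSided.riccati_twoSided_eq_zero` (`q' = −b q²`, `b ≥ b₀ > 0` ⇒ `q ≡ 0`).  The class, however, only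
provides NON-uniform genuine nonlinearity: at the densely hyperbolic time the slope function is `≤ 0` with ISOLATED sonic values and
is genuinely nonlinear at SOME attained value (`…ZShockSonicValues.gn_or_globalTH_of_class`, `…ZShockGenuineNonlinearity`), so along
a characteristic the Riccati coefficient `b = (κ'(w)/2κ(w))·e^{−h}` is `≥ 0` but NOT bounded below by a positive constant — the
repair census of the previous hands names «R2 with non-uniform genuine nonlinearity» as the next brick.  This file settles the ODE
level of that brick exactly:

* `antideriv_sub_le_inv_sub_inv` — on a positivity interval, `1/q` grows at least like any antiderivative `B` of a minorant
  `β ≤ b` (`B(y) − B(x) ≤ 1/q(y) − 1/q(x)`; the tree's `inv_sub_inv_ge` is the case `β ≡ C`);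
* `antideriv_incr_lt_inv_of_riccati_backward` — BACKWARD BUDGET: `b ≥ β ≥ 0` on `[z₁, z₀]`, `q(z₀) > 0` ⇒
  `B(z₀) − B(z₁) < 1/q(z₀)` (the accumulated genuine nonlinearity behind a positive datum is bounded by `1/q(z₀)`);
* `riccati_twoSided_eq_zero_of_unbounded` — ★ TWO-SIDED LIOUVILLE UNDER DIVERGENCE: `q' = −b q²` on `ℝ`, `b ≥ β ≥ 0`, and an
  antiderivative `B` of `β` unbounded above AND below (i.e. `∫^{+∞} β = ∫_{−∞} β = +∞`) ⇒ `q ≡ 0`; sign twin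
  `riccati_twoSided_eq_zero_of_unbounded_neg` (`b ≤ −β ≤ 0`);
* `dampedRiccati_twoSided_eq_zero_of_unbounded` (+ `_neg`) — John's damped form `α' = −aα² − h'α`, `a ≥ 0`, `|h| ≤ H`, an
  antiderivative `A` of `a` unbounded above and below ⇒ `α ≡ 0` (substitution `q = e^{h}α`, minorant `e^{−H}a`);
* `riccati_twoSided_integrable_witness` — ★ THE CONDITION IS SHARP AT THE ODE LEVEL: `q(z) = 1/(2 + arctan z)` is a smooth,
  bounded, positive, non-constant TWO-SIDED ETERNAL solution of `q' = −b q²` with `b(z) = 1/(1 + z²) > 0` AT EVERY HEIGHT — strict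
  (but non-uniform) genuine nonlinearity along the whole characteristic does NOT force `q ≡ 0`; only divergence of `∫ b` in both
  directions does.

CONSEQUENCE FOR R2/R3 (recorded, not formalised here): the Lax–John mechanism closes the non-uniform case iff along every
characteristic through a point with non-zero transversal derivative the integral `∫ κ'(w(z, X(z))) dz` diverges in BOTH height
directions; it is automatic under uniform GN and FAILS exactly when `w` tends, along a characteristic, to a linearly degenerate value
(a sonic/inflection value of the slope function) fast enough — this, and not «κ' may vanish at isolated values», is the residual
content of the non-uniform 1-D shadow.  [folklore] (Lax 1964 (2.6); John 1974 §2; Hörmander 1997 §4.2)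
-/

noncomputable section

namespace Summit.NavierStokesRegularity.NavierStokesRegularity.Theorems.PoloidalWindowDoorPoloidalWindowRigidityZShockRiccatiDivergent

-- the summit and its single sub-problem share the name (CONVENTIONS §1)
set_option linter.dupNamespace false

open Set Filter Topology
open Summit.NavierStokesRegularity.NavierStokesRegularity.Theorems.PoloidalWindowDoorPoloidalWindowRigidityZShockRiccatiTwoSided

/-! ## The backward budget with a divergent minorant -/

/-- **`1/q` dominates every antiderivative of a minorant of `b`.**  If `q' = −b q²` at every point of `[x, y]`, `q > 0` on
`[x, y]`, and `B' = β` with `β ≤ b` on `[x, y]`, then `B(y) − B(x) ≤ 1/q(y) − 1/q(x)` (the function `1/q − B` has derivative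
`b − β ≥ 0`).  The tree's `inv_sub_inv_ge` is the case `B(z) = C·z`. [folklore] -/
theorem antideriv_sub_le_inv_sub_inv {q b β B : ℝ → ℝ} {x y : ℝ} (hxy : x ≤ y)
    (hq : ∀ z ∈ Icc x y, HasDerivAt q (-(b z * q z ^ 2)) z)
    (hpos : ∀ z ∈ Icc x y, 0 < q z)
    (hB : ∀ z ∈ Icc x y, HasDerivAt B (β z) z) (hβb : ∀ z ∈ Icc x y, β z ≤ b z) :
    B y - B x ≤ (q y)⁻¹ - (q x)⁻¹ := by
  -- `φ = 1/q − B` has derivative `b − β` at every point of `[x, y]`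
  have hφ : ∀ z ∈ Icc x y, HasDerivAt (fun w => (q w)⁻¹ - B w) (b z - β z) z := by
    intro z hz
    have hne : q z ≠ 0 := (hpos z hz).ne'
    have h := ((hq z hz).inv hne).sub (hB z hz)
    refine h.congr_deriv ?_
    have e : -(-(b z * q z ^ 2)) / q z ^ 2 = b z := by
      rw [neg_neg, mul_div_assoc, div_self (pow_ne_zero 2 hne), mul_one]
    rw [e]
  have hcont : ContinuousOn (fun w => (q w)⁻¹ - B w) (Icc x y) :=
    fun z hz => (hφ z hz).continuousAt.continuousWithinAt
  have hdiff : DifferentiableOn ℝ (fun w => (q w)⁻¹ - B w) (interior (Icc x y)) := by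
    intro z hz
    rw [interior_Icc] at hz
    exact (hφ z (Ioo_subset_Icc_self hz)).differentiableAt.differentiableWithinAt
  have hge : ∀ z ∈ interior (Icc x y), (0 : ℝ) ≤ deriv (fun w => (q w)⁻¹ - B w) z := by
    intro z hz
    rw [interior_Icc] at hz
    rw [(hφ z (Ioo_subset_Icc_self hz)).deriv]
    exact sub_nonneg.2 (hβb z (Ioo_subset_Icc_self hz))
  have h := (convex_Icc x y).mul_sub_le_image_sub_of_le_deriv hcont hdiff hge x (left_mem_Icc.2 hxy) y
    (right_mem_Icc.2 hxy) hxy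
  simp only [zero_mul] at h
  linarith

/-- **Backward budget.**  If `q' = −b q²` on `[z₁, z₀]` with `b ≥ β ≥ 0` there, `B' = β` on `[z₁, z₀]` and `q(z₀) > 0`, then
`B(z₀) − B(z₁) < 1/q(z₀)`: behind a positive datum the accumulated (minorised) genuine nonlinearity `∫_{z₁}^{z₀} β` stays below
`1/q(z₀)` — `q` stays `≥ q(z₀) > 0` backward (`le_of_riccati_backward`) and `1/q(z₁) > 0`. [folklore] -/
theorem antideriv_incr_lt_inv_of_riccati_backward {q b β B : ℝ → ℝ} {z₁ z₀ : ℝ} (hz : z₁ ≤ z₀)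
    (hq : ∀ z ∈ Icc z₁ z₀, HasDerivAt q (-(b z * q z ^ 2)) z)
    (hβ : ∀ z ∈ Icc z₁ z₀, 0 ≤ β z) (hβb : ∀ z ∈ Icc z₁ z₀, β z ≤ b z)
    (hB : ∀ z ∈ Icc z₁ z₀, HasDerivAt B (β z) z) (hpos : 0 < q z₀) :
    B z₀ - B z₁ < (q z₀)⁻¹ := by
  have hb : ∀ z ∈ Icc z₁ z₀, 0 ≤ b z := fun z hzI => (hβ z hzI).trans (hβb z hzI)
  have hposI : ∀ z ∈ Icc z₁ z₀, 0 < q z := fun z hzI =>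
    hpos.trans_le (le_of_riccati_backward hq hb hpos z hzI)
  have h := antideriv_sub_le_inv_sub_inv hz hq hposI hB hβb
  have h1 : 0 < (q z₁)⁻¹ := inv_pos.2 (hposI z₁ (left_mem_Icc.2 hz))
  linarith

/-! ## Two-sided Liouville under divergence of `∫ b` in both directions -/

/-- **★ Two-sided Riccati Liouville lemma under NON-UNIFORM genuine nonlinearity.**  If `q : ℝ → ℝ` satisfies
`q'(z) = −b(z) q(z)²` at every `z ∈ ℝ`, where `b ≥ β ≥ 0` and some antiderivative `B` of `β` (`B' = β`) is UNBOUNDED ABOVE AND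
BELOW — i.e. `∫_{z₀}^{+∞} β = +∞ = ∫_{−∞}^{z₀} β` — then `q ≡ 0`.  A positive value `q(z₀) > 0` would bound `B` from below by
`B(z₀) − 1/q(z₀)` (backward budget behind `z₀`; monotonicity of `B` ahead of `z₀`); a negative value is a positive value of the
reflected solution `y ↦ −q(−y)` (coefficient `b(−y)`, minorant `β(−y)`, antiderivative `−B(−y)`, unbounded below because `B` is
unbounded above).  The tree's `riccati_twoSided_eq_zero` is the case `β ≡ b₀ > 0`, `B(z) = b₀ z`. [folklore] -/
theorem riccati_twoSided_eq_zero_of_unbounded {q b β B : ℝ → ℝ}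
    (hβ : ∀ z, 0 ≤ β z) (hβb : ∀ z, β z ≤ b z) (hB : ∀ z, HasDerivAt B (β z) z)
    (hup : ∀ K : ℝ, ∃ z, K < B z) (hdown : ∀ K : ℝ, ∃ z, B z < K)
    (hq : ∀ z, HasDerivAt q (-(b z * q z ^ 2)) z) : ∀ z, q z = 0 := by
  -- no positive value anywhere: `B` would be bounded below
  have nopos : ∀ {q b β B : ℝ → ℝ}, (∀ z, 0 ≤ β z) → (∀ z, β z ≤ b z) → (∀ z, HasDerivAt B (β z) z) →
      (∀ K : ℝ, ∃ z, B z < K) → (∀ z, HasDerivAt q (-(b z * q z ^ 2)) z) → ∀ z₀, q z₀ ≤ 0 := by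
    intro q b β B hβ hβb hB hdown hq z₀
    by_contra hpos'
    have hpos : 0 < q z₀ := not_le.1 hpos'
    have hBmono : Monotone B :=
      monotone_of_deriv_nonneg (fun z => (hB z).differentiableAt) fun z => by
        rw [(hB z).deriv]; exact hβ z
    obtain ⟨z, hz⟩ := hdown (B z₀ - (q z₀)⁻¹)
    rcases le_total z z₀ with hle | hle
    · -- behind `z₀`: the backward budget
      have h := antideriv_incr_lt_inv_of_riccati_backward hle (fun w _ => hq w) (fun w _ => hβ w)
        (fun w _ => hβb w) (fun w _ => hB w) hpos
      linarith
    · -- ahead of `z₀`: `B` is monotone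
      have h := hBmono hle
      have : 0 < (q z₀)⁻¹ := inv_pos.2 hpos
      linarith
  intro z₀
  have h1 : q z₀ ≤ 0 := nopos hβ hβb hB hdown hq z₀
  -- the reflected solution
  have hQ : ∀ y, HasDerivAt (fun y => -q (-y)) (-(b (-y) * (-q (-y)) ^ 2)) y := by
    intro y
    have h := ((hq (-y)).comp y (hasDerivAt_neg y)).neg
    exact h.congr_deriv (by ring)
  have hBr : ∀ y, HasDerivAt (fun y => -B (-y)) (β (-y)) y := by
    intro y
    have h := ((hB (-y)).comp y (hasDerivAt_neg y)).neg
    exact h.congr_deriv (by ring)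
  have hdown' : ∀ K : ℝ, ∃ y, -B (-y) < K := by
    intro K
    obtain ⟨z, hz⟩ := hup (-K)
    exact ⟨-z, by rw [neg_neg]; linarith⟩
  have h2 : -q (-(-z₀)) ≤ 0 := nopos (fun y => hβ (-y)) (fun y => hβb (-y)) hBr hdown' hQ (-z₀)
  rw [neg_neg] at h2
  linarith

/-- **Sign twin** (`b ≤ −β ≤ 0`, an antiderivative of `β` unbounded above and below ⇒ `q ≡ 0`): `−q` solves the law with
coefficient `−b ≥ β`. [folklore] -/
theorem riccati_twoSided_eq_zero_of_unbounded_neg {q b β B : ℝ → ℝ}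
    (hβ : ∀ z, 0 ≤ β z) (hb : ∀ z, b z ≤ -β z) (hB : ∀ z, HasDerivAt B (β z) z)
    (hup : ∀ K : ℝ, ∃ z, K < B z) (hdown : ∀ K : ℝ, ∃ z, B z < K)
    (hq : ∀ z, HasDerivAt q (-(b z * q z ^ 2)) z) : ∀ z, q z = 0 := by
  have hQ : ∀ z, HasDerivAt (fun z => -q z) (-((-b z) * (-q z) ^ 2)) z := fun z =>
    (hq z).neg.congr_deriv (by ring)
  have h := riccati_twoSided_eq_zero_of_unbounded (q := fun z => -q z) (b := fun z => -b z) hβ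
    (fun z => by linarith [hb z]) hB hup hdown hQ
  intro z
  have := h z
  simp only [neg_eq_zero] at this
  exact this

/-! ## John's damped form -/

/-- **Damped law under divergence (John's integrating factor).**  If `α' = −a·α² − h'·α` on `ℝ` with `a ≥ 0`, `|h| ≤ H`
(`h' =` the derivative of `h`) and some antiderivative `A` of `a` is unbounded above and below, then `α ≡ 0`: `q := e^{h}α` obeys
`q' = −(a e^{−h}) q²` with `a e^{−h} ≥ e^{−H} a =: β ≥ 0`, and `e^{−H} A` is an antiderivative of `β`, unbounded both ways.  Along a
characteristic of the genuinely nonlinear p-system `a = κ'(w)/(2κ(w))` and `h = ½ log κ(w)`: the hypothesis is the divergence of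
`∫ κ'(w(z, X(z))) dz` in both height directions. [folklore] -/
theorem dampedRiccati_twoSided_eq_zero_of_unbounded {α a h h' A : ℝ → ℝ} {H : ℝ} (ha : ∀ z, 0 ≤ a z)
    (hH : ∀ z, |h z| ≤ H) (hh : ∀ z, HasDerivAt h (h' z) z) (hA : ∀ z, HasDerivAt A (a z) z)
    (hup : ∀ K : ℝ, ∃ z, K < A z) (hdown : ∀ K : ℝ, ∃ z, A z < K)
    (hα : ∀ z, HasDerivAt α (-(a z * α z ^ 2) - h' z * α z) z) : ∀ z, α z = 0 := by
  -- `q := e^{h} α` solves the undamped law with coefficient `a e^{-h}`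
  set q : ℝ → ℝ := fun z => Real.exp (h z) * α z with hq
  have hqd : ∀ z, HasDerivAt q (-(a z * Real.exp (-h z) * q z ^ 2)) z := by
    intro z
    have he : HasDerivAt (fun y => Real.exp (h y)) (Real.exp (h z) * h' z) z := (hh z).exp
    have hprod := he.mul (hα z)
    refine hprod.congr_deriv ?_
    have hexp : Real.exp (-h z) * Real.exp (h z) = 1 := by rw [← Real.exp_add]; simp
    simp only [hq]
    have : a z * Real.exp (-h z) * (Real.exp (h z) * α z) ^ 2 =
        a z * α z ^ 2 * Real.exp (h z) * (Real.exp (-h z) * Real.exp (h z)) := by ring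
    rw [this, hexp]
    ring
  -- minorant `β = e^{-H} a` with antiderivative `e^{-H} A`
  have hβ : ∀ z, 0 ≤ Real.exp (-H) * a z := fun z => mul_nonneg (Real.exp_pos _).le (ha z)
  have hβb : ∀ z, Real.exp (-H) * a z ≤ a z * Real.exp (-h z) := by
    intro z
    have h1 : Real.exp (-H) ≤ Real.exp (-h z) := Real.exp_le_exp.2 (by linarith [hH z, le_abs_self (h z)])
    rw [mul_comm]
    exact mul_le_mul_of_nonneg_left h1 (ha z)
  have hB : ∀ z, HasDerivAt (fun z => Real.exp (-H) * A z) (Real.exp (-H) * a z) z :=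
    fun z => (hA z).const_mul _
  have hE : 0 < Real.exp (-H) := Real.exp_pos _
  have hup' : ∀ K : ℝ, ∃ z, K < Real.exp (-H) * A z := by
    intro K
    obtain ⟨z, hz⟩ := hup (K / Real.exp (-H))
    exact ⟨z, by rwa [div_lt_iff₀ hE, mul_comm] at hz⟩
  have hdown' : ∀ K : ℝ, ∃ z, Real.exp (-H) * A z < K := by
    intro K
    obtain ⟨z, hz⟩ := hdown (K / Real.exp (-H))
    exact ⟨z, by rwa [lt_div_iff₀ hE, mul_comm] at hz⟩
  have hq0 := riccati_twoSided_eq_zero_of_unbounded (b := fun z => a z * Real.exp (-h z)) hβ hβb hB hup' hdown' hqd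
  intro z
  have hz := hq0 z
  simp only [hq, mul_eq_zero, Real.exp_ne_zero, false_or] at hz
  exact hz

/-- **Damped law, the other sign** (`a ≤ 0`, an antiderivative `A` of `a` unbounded above and below ⇒ `α ≡ 0`): `−α` obeys
the damped law with coefficient `−a ≥ 0` and the same damping, and `−A` is an antiderivative of `−a`. [folklore] -/
theorem dampedRiccati_twoSided_eq_zero_of_unbounded_neg {α a h h' A : ℝ → ℝ} {H : ℝ} (ha : ∀ z, a z ≤ 0)
    (hH : ∀ z, |h z| ≤ H) (hh : ∀ z, HasDerivAt h (h' z) z) (hA : ∀ z, HasDerivAt A (a z) z)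
    (hup : ∀ K : ℝ, ∃ z, K < A z) (hdown : ∀ K : ℝ, ∃ z, A z < K)
    (hα : ∀ z, HasDerivAt α (-(a z * α z ^ 2) - h' z * α z) z) : ∀ z, α z = 0 := by
  have hβ : ∀ z, HasDerivAt (fun z => -α z) (-((-a z) * (-α z) ^ 2) - h' z * (-α z)) z := fun z =>
    (hα z).neg.congr_deriv (by ring)
  have hAn : ∀ z, HasDerivAt (fun z => -A z) (-a z) z := fun z => (hA z).neg
  have hup' : ∀ K : ℝ, ∃ z, K < -A z := fun K => by
    obtain ⟨z, hz⟩ := hdown (-K); exact ⟨z, by linarith⟩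
  have hdown' : ∀ K : ℝ, ∃ z, -A z < K := fun K => by
    obtain ⟨z, hz⟩ := hup (-K); exact ⟨z, by linarith⟩
  have h := dampedRiccati_twoSided_eq_zero_of_unbounded (α := fun z => -α z) (a := fun z => -a z)
    (fun z => by linarith [ha z]) hH hh hAn hup' hdown' hβ
  intro z
  have := h z
  simp only [neg_eq_zero] at this
  exact this

/-! ## The divergence hypothesis is sharp at the ODE level -/

/-- **★ Strict but non-uniform genuine nonlinearity does NOT suffice.**  The function `q(z) = 1/(2 + arctan z)` is a positive,
bounded (`0 < q < 1/(2 − π/2)`), non-constant solution of `q' = −b q²` on ALL of `ℝ` with the coefficient `b(z) = 1/(1 + z²)`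
STRICTLY POSITIVE AT EVERY HEIGHT (but `∫ b < ∞`).  So at the level of the characteristic ODE of rung R2, «genuinely nonlinear at
every value met along the characteristic» is strictly weaker than what the Lax–John mechanism needs; the exact condition is the
two-sided divergence of `∫ b` (`riccati_twoSided_eq_zero_of_unbounded`). [folklore] -/
theorem riccati_twoSided_integrable_witness :
    ∃ q b : ℝ → ℝ, (∀ z, 0 < b z) ∧ (∀ z, 0 < q z) ∧ (∀ z, HasDerivAt q (-(b z * q z ^ 2)) z) ∧ q 0 ≠ q 1 := by
  refine ⟨fun z => (2 + Real.arctan z)⁻¹, fun z => 1 / (1 + z ^ 2), fun z => by positivity, fun z => ?_, fun z => ?_, ?_⟩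
  · have h : 0 < 2 + Real.arctan z := by
      linarith [Real.neg_pi_div_two_lt_arctan z, Real.pi_lt_four]
    exact inv_pos.2 h
  · have hpos : 0 < 2 + Real.arctan z := by
      linarith [Real.neg_pi_div_two_lt_arctan z, Real.pi_lt_four]
    have hd : HasDerivAt (fun y => 2 + Real.arctan y) (1 / (1 + z ^ 2)) z := by
      simpa using (Real.hasDerivAt_arctan z).const_add 2
    have h := hd.inv hpos.ne'
    refine h.congr_deriv ?_
    beta_reduce
    rw [inv_pow]
    ring
  · -- `arctan 0 = 0 ≠ arctan 1 = π/4`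
    simp only [ne_eq, inv_inj, Real.arctan_zero, Real.arctan_one, add_zero]
    intro h
    linarith [Real.pi_pos]

end Summit.NavierStokesRegularity.NavierStokesRegularity.Theorems.PoloidalWindowDoorPoloidalWindowRigidityZShockRiccatiDivergent

end
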